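import Literature.Computability.QuantumComplexity.GoldenArithmetic
import HarnessLib

/-!
# [EtTh] Prop 3.4 (ii) / Def 3.6 (i), `Λ = ℝ`, at TREE-LIKE tempered coverings — the TREE MODEL, part 1:
# the 3-regular tree `T₃`, the INTEGER minimum principle, and a POSITIVE NON-CONSTANT HARMONIC function with
# increments in `ℤ[φ]` (the golden pair)

MODEL companion in the series `Discharge/Sec3*.lean`, cell abc-iut, sub-DAG `plan/L2/SUBDAG-EtTh-Thm37.md`, row
«EtTh:Thm3.7(iii)/L10-R», GAP-LEDGER G-w5d130-1; sequel of the CHAIN MODEL `Sec3Prop34CnstOfRlfRChainModel.lean`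
(the `Ÿ`-type case: dual graph the bi-infinite chain `ℤ`, where the `B₀`-level clause of Prop. 3.4 (ii) AND its
`Λ = ℝ` companion `hE` are theorems by the discrete maximum principle).  S. Mochizuki, *The étale theta function …*,
Publ. RIMS **45** (2009) [EtTh], §3: universal combinatorial coverings `Z∞ → Z`, `Mero(Z∞^log)` Def. 3.1 p.70,
Prop. 3.2 p.70, Def. 3.3 (iii) p.73, Prop. 3.4 (ii) p.74, Def. 3.6 (i) p.76, Thm. 3.7 (iii) p.79 (PDF pages)
[cite: MochizukiEtTh2009, Prop 3.4 (ii) p.74].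

QUESTION (cell v-next census item A2; proposed v2 structure 'DualGraphDivisorData' = components ⊔ cusps + the law
(L) `div(f) = (ord_C f, −Δ ord_C f)`): does (L) by itself deliver `hE` (clause 1 of
`RealifiedDivisorMonoids.Prop34Cnst (ofRlfR dm hpf) cnst`) at every dual graph?  ANSWER (parts 1–2): NO.  What made
`hE` true on the chain is the LIOUVILLE property of `ℤ` (a non-negative superharmonic function is constant), which
fails on every tree with branching: such a tree carries non-constant POSITIVE HARMONIC functions — and, the point of
this file, even ones with increments in the lattice `ℤ + ℤφ`, `φ = (1+√5)/2`, i.e. `ψ = A + φ·B` with `A, B`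
INTEGER-valued and HARMONIC (the golden splitting `1 = φ⁻¹ + φ⁻²` distributes the mass of a cone over its two
sub-cones inside `ℤ[φ]`).  THIS FILE (pure combinatorics, no Frobenioid vocabulary): the tree `T₃` (vertices
`V := ℤ × ℕ`, `(m, k)` = the dyadic interval `[k·2^m, (k+1)·2^m)`; parent `(m+1, ⌊k/2⌋)`, children `(m−1, 2k)`,
`(m−1, 2k+1)`; `T₃` is the universal cover of every finite 3-regular dual graph, `b₁ ≥ 2`), its Laplacian `lap`;
the INTEGER MINIMUM PRINCIPLE `const_of_lap_nonpos_of_nonneg` (an integer-valued `φ ≥ 0` with `lap φ ≤ 0` is constant: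
the minimum is attained, and `T₃` is connected through its spine) — the engine of the `B₀`-level clause of Prop. 3.4
(ii) at tree-like coverings; and the GOLDEN PAIR `Psi : V → ℤ[φ]` (`Psi(m,0) = φ^{m+1}` on the spine,
`Psi(child) = Psi(v) − W(child)` with cone masses `W(m,k) = φ^{m − popcount k}`), HARMONIC (`lap_Psi`), with integer
coordinates `hA := re Psi`, `hB := im Psi` harmonic (`lap_A`, `lap_B`), real value `hA + φ·hB > 0` at every vertex
(`toReal_Psi_pos`, invariant `φ·W ≤ Psi`) and not constant (`toReal_Psi_zero_ne`).  Part 2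
(`Sec3Prop34CnstOfRlfRTreeModelNegative.lean`) builds the Def. 3.3 (iii) data with the law (L) on `Prime = V ⊔ V`,
proves `Prop34` + `Prop34Cnst₀` there, and shows that `β := ι(div hA)·φ•ι(div hB) ∈ ℝ·Φ₀^birat` is EFFECTIVE and not in
`ℝ·Φ₀^cnst`: `hE` and `Prop34Cnst (ofRlfR dm hpf) (𝟭 _)` FAIL at the tree model.  `ℤ[φ]` arithmetic:
`Literature.Computability.QuantumComplexity.GoldenArithmetic` (`ZPhi`, `ZPhi.toReal`).  HONEST FRAMING: a MODEL over
the cell's abstract interfaces (the dictionary to genuine tree-like coverings `Z∞`, via van der Put's description of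
the analytic units on `Ω_𝓛`, is in part 2's docstring and is NOT kernel-checked); Prop. 3.4 (ii) itself HOLDS at the
model; nothing here bears on [IUTchIII] Cor. 3.12; typed ≠ proved.  Seat abc-iut-w6-d046 (gen 3).
-/

noncomputable section

namespace Literature.AnabelianGeometry.EtaleTheta

open Literature.Computability.QuantumComplexity

namespace Sec3Prop34CnstOfRlfRTreeModel

/-! ### The 3-regular tree `T₃`: vertices `ℤ × ℕ` (dyadic intervals), parent and children -/

/-- The vertices of `T₃`: `(m, k)` is the dyadic interval `[k·2^m, (k+1)·2^m)` of `[0, ∞)`.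
[cite: MochizukiEtTh2009, Def 3.3 p.73] -/
abbrev V : Type := ℤ × ℕ

/-- The parent `(m+1, ⌊k/2⌋)` (the dyadic interval of double length containing `(m, k)`).
[cite: MochizukiEtTh2009, Def 3.3 p.73] -/
def parent (v : V) : V := (v.1 + 1, v.2 / 2)
/-- The first child `(m−1, 2k)` (left half). [cite: MochizukiEtTh2009, Def 3.3 p.73] -/
def child₀ (v : V) : V := (v.1 - 1, 2 * v.2)
/-- The second child `(m−1, 2k+1)` (right half). [cite: MochizukiEtTh2009, Def 3.3 p.73] -/
def child₁ (v : V) : V := (v.1 - 1, 2 * v.2 + 1)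

/-- `parent (child₀ v) = v`. [cite: MochizukiEtTh2009, Def 3.3 p.73] -/
@[simp] theorem parent_child₀ (v : V) : parent (child₀ v) = v := by
  obtain ⟨m, k⟩ := v
  simp only [parent, child₀, Prod.mk.injEq]
  omega
/-- `parent (child₁ v) = v`. [cite: MochizukiEtTh2009, Def 3.3 p.73] -/
@[simp] theorem parent_child₁ (v : V) : parent (child₁ v) = v := by
  obtain ⟨m, k⟩ := v
  simp only [parent, child₁, Prod.mk.injEq]
  omega
/-- Every vertex is a child of its parent. [cite: MochizukiEtTh2009, Def 3.3 p.73] -/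
theorem eq_child_parent (v : V) : v = child₀ (parent v) ∨ v = child₁ (parent v) := by
  obtain ⟨m, k⟩ := v
  rcases Nat.mod_two_eq_zero_or_one k with h | h
  · left
    simp only [parent, child₀, Prod.mk.injEq]
    omega
  · right
    simp only [parent, child₁, Prod.mk.injEq]
    omega

/-- **The Laplacian of `T₃`**: `lap φ (v) = Σ_{w ∼ v} (φ w − φ v)` over the three neighbours parent, `child₀`,
`child₁`. [cite: MochizukiEtTh2009, Def 3.3 p.73] -/
def lap (φ : V → ℤ) (v : V) : ℤ := φ (parent v) + φ (child₀ v) + φ (child₁ v) - 3 * φ v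

/-- `lap` is additive. [cite: MochizukiEtTh2009, Def 3.3 p.73] -/
theorem lap_add (φ ψ : V → ℤ) (v : V) : lap (φ + ψ) v = lap φ v + lap ψ v := by
  simp only [lap, Pi.add_apply]
  ring

/-! ### The integer minimum principle on `T₃` -/

/-- **An integer-valued non-negative superharmonic function on `T₃` is constant** (the minimum is attained; at a
minimum the three neighbours are minima; `T₃` is connected through the spine `(m, 0)`).  The engine behind
"`div(f)` effective ⇒ `f` constant" at the `B₀`-level for tree-like coverings. [cite: MochizukiEtTh2009, Prop 3.4 (ii) p.74] -/
theorem const_of_lap_nonpos_of_nonneg (φ : V → ℤ) (hlap : ∀ v, lap φ v ≤ 0) (hpos : ∀ v, 0 ≤ φ v) (v : V) :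
    φ v = φ (0, 0) := by
  classical
  -- a vertex of minimal value
  obtain ⟨v₀, hv₀⟩ : ∃ v₀, ∀ w, φ v₀ ≤ φ w := by
    refine ⟨Function.argmin (fun w => (φ w).toNat), fun w => ?_⟩
    have h := Function.argmin_le (fun w => (φ w).toNat) w
    have h1 := Int.toNat_of_nonneg (hpos (Function.argmin (fun w => (φ w).toNat)))
    have h2 := Int.toNat_of_nonneg (hpos w)
    omega
  -- at a minimum all three neighbours are minima
  have hnb : ∀ w, φ w = φ v₀ → φ (parent w) = φ v₀ ∧ φ (child₀ w) = φ v₀ ∧ φ (child₁ w) = φ v₀ := by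
    intro w hw
    have h1 := hlap w
    rw [lap, hw] at h1
    have h2 := hv₀ (parent w)
    have h3 := hv₀ (child₀ w)
    have h4 := hv₀ (child₁ w)
    omega
  -- climbing to the spine
  have hup : ∀ k m, φ (m, k) = φ v₀ → ∃ m', φ (m', 0) = φ v₀ := by
    intro k
    induction k using Nat.strong_induction_on with
    | _ k ih =>
      intro m hm
      rcases Nat.eq_zero_or_pos k with rfl | hk
      · exact ⟨m, hm⟩
      · have h1 := (hnb (m, k) hm).1
        exact ih (k / 2) (Nat.div_lt_self hk one_lt_two) (m + 1) h1
  obtain ⟨m₁, hm₁⟩ := hup v₀.2 v₀.1 rfl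
  -- the whole spine
  have hge : ∀ n : ℕ, φ (m₁ + n, 0) = φ v₀ := by
    intro n
    induction n with
    | zero => simpa using hm₁
    | succ n ih =>
      have h1 := (hnb (m₁ + n, 0) ih).1
      rwa [parent, Nat.zero_div, show m₁ + (n : ℤ) + 1 = m₁ + ((n + 1 : ℕ) : ℤ) by push_cast; ring] at h1
  have hle : ∀ n : ℕ, φ (m₁ - n, 0) = φ v₀ := by
    intro n
    induction n with
    | zero => simpa using hm₁
    | succ n ih =>
      have h1 := (hnb (m₁ - n, 0) ih).2.1
      rwa [child₀, mul_zero, show m₁ - (n : ℤ) - 1 = m₁ - ((n + 1 : ℕ) : ℤ) by push_cast; ring] at h1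
  have hspine : ∀ m, φ (m, 0) = φ v₀ := by
    intro m
    rcases le_or_gt m₁ m with h | h
    · obtain ⟨n, hn⟩ := Int.le.dest h
      rw [← hn]
      exact hge n
    · obtain ⟨n, hn⟩ := Int.le.dest h.le
      rw [show m = m₁ - n by omega]
      exact hle n
  -- every vertex, by strong induction on `k`
  have hall : ∀ k m, φ (m, k) = φ v₀ := by
    intro k
    induction k using Nat.strong_induction_on with
    | _ k ih =>
      intro m
      rcases Nat.eq_zero_or_pos k with rfl | hk
      · exact hspine m
      · have hpar : φ (parent (m, k)) = φ v₀ := ih (k / 2) (Nat.div_lt_self hk one_lt_two) (m + 1)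
        rcases eq_child_parent (m, k) with h | h
        · rw [h]; exact (hnb _ hpar).2.1
        · rw [h]; exact (hnb _ hpar).2.2
  rw [hall v.2 v.1, hall 0 0]

/-! ### The golden pair: a positive non-constant harmonic function with increments in `ℤ[φ]` -/

/-- The golden ratio `φ` as a unit of `ℤ[φ]` (inverse `τ = φ − 1`). [cite: MochizukiEtTh2009, Def 3.3 p.73] -/
def phiU : ZPhiˣ where
  val := ZPhi.phi
  inv := ZPhi.tau
  val_inv := by decide
  inv_val := ZPhi.tau_mul_phi

/-- `φ^m ∈ ℤ[φ]`, `m ∈ ℤ`. [cite: MochizukiEtTh2009, Def 3.3 p.73] -/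
def gp (m : ℤ) : ZPhi := ((phiU ^ m : ZPhiˣ) : ZPhi)

/-- `φ^{m+1} = φ^m · φ`. [cite: MochizukiEtTh2009, Prop 3.4 (ii) p.74] -/
theorem gp_add_one (m : ℤ) : gp (m + 1) = gp m * ZPhi.phi := by
  rw [gp, zpow_add_one, Units.val_mul]
  rfl

/-- `φ^{m−1} = φ^m · τ`. [cite: MochizukiEtTh2009, Prop 3.4 (ii) p.74] -/
theorem gp_sub_one (m : ℤ) : gp (m - 1) = gp m * ZPhi.tau := by
  rw [gp, zpow_sub_one, Units.val_mul]
  rfl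

/-- `φ² = φ + 1`, `τ = φ − 1`, `1 = τ + τ²` in `ℤ[φ]`. [cite: MochizukiEtTh2009, Prop 3.4 (ii) p.74] -/
theorem phi_sq : ZPhi.phi * ZPhi.phi = ZPhi.phi + 1 ∧ ZPhi.tau = ZPhi.phi - 1 ∧
    (1 : ZPhi) - ZPhi.tau - ZPhi.tau ^ 2 = 0 := by
  refine ⟨by decide, by decide, by decide⟩

/-- **The cone masses** `W(m, k) = φ^m · τ^{popcount k}`: `W(m, 0) = φ^m` on the spine, and the mass of a vertex
splits over its two children as `W·τ + W·τ² = W` (the golden splitting). [cite: MochizukiEtTh2009, Def 3.3 p.73] -/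
def W : ℤ → ℕ → ZPhi
  | m, 0 => gp m
  | m, k + 1 => W (m + 1) ((k + 1) / 2) * if (k + 1) % 2 = 0 then ZPhi.tau else ZPhi.tau ^ 2
termination_by _ k => k
decreasing_by omega

/-- **The golden harmonic function** `Psi : T₃ → ℤ[φ]`: `Psi(m, 0) = φ^{m+1}` on the spine and
`Psi(child) = Psi(parent) − W(child)`. [cite: MochizukiEtTh2009, Def 3.3 p.73] -/
def Psi : ℤ → ℕ → ZPhi
  | m, 0 => gp (m + 1)
  | m, k + 1 => Psi (m + 1) ((k + 1) / 2) - W m (k + 1)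
termination_by _ k => k
decreasing_by omega

/-- `W` on the spine. [cite: MochizukiEtTh2009, Prop 3.4 (ii) p.74] -/
theorem W_zero (m : ℤ) : W m 0 = gp m := by
  rw [W]
/-- `W` off the spine (the defining equation). [cite: MochizukiEtTh2009, Prop 3.4 (ii) p.74] -/
theorem W_of_pos (m : ℤ) {k : ℕ} (hk : 0 < k) :
    W m k = W (m + 1) (k / 2) * if k % 2 = 0 then ZPhi.tau else ZPhi.tau ^ 2 := by
  obtain ⟨j, rfl⟩ := Nat.exists_eq_succ_of_ne_zero hk.ne'
  rw [W]
/-- `Psi` on the spine. [cite: MochizukiEtTh2009, Prop 3.4 (ii) p.74] -/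
theorem Psi_zero (m : ℤ) : Psi m 0 = gp (m + 1) := by
  rw [Psi]
/-- `Psi` off the spine (the defining equation). [cite: MochizukiEtTh2009, Prop 3.4 (ii) p.74] -/
theorem Psi_of_pos (m : ℤ) {k : ℕ} (hk : 0 < k) : Psi m k = Psi (m + 1) (k / 2) - W m k := by
  obtain ⟨j, rfl⟩ := Nat.exists_eq_succ_of_ne_zero hk.ne'
  rw [Psi]

/-- `W` at a vertex. [cite: MochizukiEtTh2009, Def 3.3 p.73] -/
def Wv (v : V) : ZPhi := W v.1 v.2
/-- `Psi` at a vertex. [cite: MochizukiEtTh2009, Def 3.3 p.73] -/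
def PsiV (v : V) : ZPhi := Psi v.1 v.2

/-- The mass of the first child: `W(child₀ v) = W(v)·τ`. [cite: MochizukiEtTh2009, Prop 3.4 (ii) p.74] -/
theorem Wv_child₀ (v : V) : Wv (child₀ v) = Wv v * ZPhi.tau := by
  obtain ⟨m, k⟩ := v
  simp only [Wv, child₀]
  rcases Nat.eq_zero_or_pos k with rfl | hk
  · rw [mul_zero, W_zero, W_zero, gp_sub_one]
  · rw [W_of_pos _ (by omega : 0 < 2 * k), if_pos (by omega), show m - 1 + 1 = m by ring,
      show 2 * k / 2 = k by omega]

/-- The mass of the second child: `W(child₁ v) = W(v)·τ²`. [cite: MochizukiEtTh2009, Prop 3.4 (ii) p.74] -/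
theorem Wv_child₁ (v : V) : Wv (child₁ v) = Wv v * ZPhi.tau ^ 2 := by
  obtain ⟨m, k⟩ := v
  simp only [Wv, child₁]
  rw [W_of_pos _ (by omega : 0 < 2 * k + 1), if_neg (by omega), show m - 1 + 1 = m by ring,
    show (2 * k + 1) / 2 = k by omega]

/-- `Psi(parent v) = Psi(v) + W(v)`. [cite: MochizukiEtTh2009, Prop 3.4 (ii) p.74] -/
theorem PsiV_parent (v : V) : PsiV (parent v) = PsiV v + Wv v := by
  obtain ⟨m, k⟩ := v
  simp only [PsiV, Wv, parent]
  rcases Nat.eq_zero_or_pos k with rfl | hk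
  · rw [Nat.zero_div, Psi_zero, Psi_zero, W_zero, show m + 1 + 1 = m + 1 + 1 by rfl, gp_add_one, gp_add_one]
    linear_combination gp m * phi_sq.1
  · rw [Psi_of_pos m hk]
    ring

/-- `Psi(child₀ v) = Psi(v) − W(child₀ v)`. [cite: MochizukiEtTh2009, Prop 3.4 (ii) p.74] -/
theorem PsiV_child₀ (v : V) : PsiV (child₀ v) = PsiV v - Wv (child₀ v) := by
  obtain ⟨m, k⟩ := v
  simp only [PsiV, Wv, child₀]
  rcases Nat.eq_zero_or_pos k with rfl | hk
  · rw [mul_zero, Psi_zero, Psi_zero, W_zero, show m - 1 + 1 = m by ring, gp_sub_one, gp_add_one]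
    linear_combination gp m * phi_sq.2.1
  · rw [Psi_of_pos _ (by omega : 0 < 2 * k), show m - 1 + 1 = m by ring, show 2 * k / 2 = k by omega]

/-- `Psi(child₁ v) = Psi(v) − W(child₁ v)`. [cite: MochizukiEtTh2009, Prop 3.4 (ii) p.74] -/
theorem PsiV_child₁ (v : V) : PsiV (child₁ v) = PsiV v - Wv (child₁ v) := by
  obtain ⟨m, k⟩ := v
  simp only [PsiV, Wv, child₁]
  rw [Psi_of_pos _ (by omega : 0 < 2 * k + 1), show m - 1 + 1 = m by ring, show (2 * k + 1) / 2 = k by omega]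

/-- **`Psi` is HARMONIC on `T₃`** (in `ℤ[φ]`): `Psi(parent) + Psi(child₀) + Psi(child₁) − 3Psi = W·(1 − τ − τ²) = 0`.
[cite: MochizukiEtTh2009, Prop 3.4 (ii) p.74] -/
theorem lap_Psi (v : V) : PsiV (parent v) + PsiV (child₀ v) + PsiV (child₁ v) - 3 * PsiV v = 0 := by
  rw [PsiV_parent, PsiV_child₀, PsiV_child₁, Wv_child₀, Wv_child₁]
  linear_combination Wv v * phi_sq.2.2

/-- The integer coordinate `hA := re Ψ` of the golden harmonic function (`Ψ = hA + hB·φ`). [cite: MochizukiEtTh2009, Def 3.3 p.73] -/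
def hA (v : V) : ℤ := (PsiV v).re
/-- The integer coordinate `hB := im Ψ`. [cite: MochizukiEtTh2009, Def 3.3 p.73] -/
def hB (v : V) : ℤ := (PsiV v).im

/-- **`hA` is an integer-valued HARMONIC function on `T₃`** (so, under the law (L), the divisor of `hA ∈ B₀` has no
cusps). [cite: MochizukiEtTh2009, Prop 3.4 (ii) p.74] -/
theorem lap_A (v : V) : lap hA v = 0 := by
  have h := congrArg QuadraticAlgebra.re (lap_Psi v)
  simp only [QuadraticAlgebra.re_add, QuadraticAlgebra.re_sub, QuadraticAlgebra.re_mul,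
    QuadraticAlgebra.re_ofNat, QuadraticAlgebra.im_ofNat, QuadraticAlgebra.re_zero] at h
  rw [lap, hA, hA, hA, hA]
  linarith

/-- **`hB` is an integer-valued HARMONIC function on `T₃`.** [cite: MochizukiEtTh2009, Prop 3.4 (ii) p.74] -/
theorem lap_B (v : V) : lap hB v = 0 := by
  have h := congrArg QuadraticAlgebra.im (lap_Psi v)
  simp only [QuadraticAlgebra.im_add, QuadraticAlgebra.im_sub, QuadraticAlgebra.im_mul,
    QuadraticAlgebra.re_ofNat, QuadraticAlgebra.im_ofNat, QuadraticAlgebra.im_zero] at h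
  rw [lap, hB, hB, hB, hB]
  linarith

/-! ### The real values `ψ = hA + φ·hB > 0` -/

open Real in
/-- `toReal φ^m = φ^m`. [cite: MochizukiEtTh2009, Prop 3.4 (ii) p.74] -/
theorem toReal_gp (m : ℤ) : ZPhi.toReal (gp m) = goldenRatio ^ m := by
  have h1 : ZPhi.toReal (gp m) = ((Units.map (ZPhi.toReal : ZPhi →* ℝ) (phiU ^ m) : ℝˣ) : ℝ) := rfl
  rw [h1, map_zpow, Units.val_zpow_eq_zpow_val]
  congr 1
  change ZPhi.toReal ZPhi.phi = goldenRatio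
  rw [ZPhi.toReal_apply]
  simp [ZPhi.phi]

open Real in
/-- `toReal τ = φ − 1 = φ⁻¹`, with `0 < φ − 1 < 1` and `φ(φ − 1) = 1`. [cite: MochizukiEtTh2009, Prop 3.4 (ii) p.74] -/
theorem toReal_tau_facts : ZPhi.toReal ZPhi.tau = goldenRatio - 1 ∧ 0 < goldenRatio - 1 ∧ goldenRatio - 1 < 1 ∧
    goldenRatio * (goldenRatio - 1) = 1 := by
  refine ⟨ZPhi.toReal_tau, by linarith [one_lt_goldenRatio], by linarith [goldenRatio_lt_two], ?_⟩
  have h := goldenRatio_sq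
  nlinarith [h]

open Real in
/-- The cone masses are positive reals. [cite: MochizukiEtTh2009, Prop 3.4 (ii) p.74] -/
theorem toReal_W_pos : ∀ (k : ℕ) (m : ℤ), 0 < ZPhi.toReal (W m k) := by
  intro k
  induction k using Nat.strong_induction_on with
  | _ k ih =>
    intro m
    rcases Nat.eq_zero_or_pos k with rfl | hk
    · rw [W_zero, toReal_gp]
      exact zpow_pos goldenRatio_pos m
    · rw [W_of_pos m hk, map_mul]
      refine mul_pos (ih (k / 2) (Nat.div_lt_self hk one_lt_two) (m + 1)) ?_
      obtain ⟨h1, h2, -, -⟩ := toReal_tau_facts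
      split_ifs
      · rw [h1]; exact h2
      · rw [map_pow, h1]; positivity

open Real in
/-- **The invariant `φ · W ≤ Psi`** down the tree (equality on the spine; the golden splitting keeps it).
[cite: MochizukiEtTh2009, Prop 3.4 (ii) p.74] -/
theorem gold_mul_W_le_Psi : ∀ (k : ℕ) (m : ℤ), goldenRatio * ZPhi.toReal (W m k) ≤ ZPhi.toReal (Psi m k) := by
  intro k
  induction k using Nat.strong_induction_on with
  | _ k ih =>
    intro m
    rcases Nat.eq_zero_or_pos k with rfl | hk
    · rw [W_zero, Psi_zero, toReal_gp, toReal_gp, zpow_add_one₀ goldenRatio_ne_zero, mul_comm]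
    · have hW := W_of_pos m hk
      rw [Psi_of_pos m hk, map_sub, hW, map_mul]
      have h0 := ih (k / 2) (Nat.div_lt_self hk one_lt_two) (m + 1)
      have hw := toReal_W_pos (k / 2) (m + 1)
      obtain ⟨h1, h2, h3, h4⟩ := toReal_tau_facts
      set w := ZPhi.toReal (W (m + 1) (k / 2))
      set p := ZPhi.toReal (Psi (m + 1) (k / 2))
      split_ifs
      · rw [h1]
        nlinarith [h0, hw, h4]
      · rw [map_pow, h1]
        have h5 : (goldenRatio - 1) ^ 2 ≤ goldenRatio - 1 := by nlinarith [h2, h3]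
        nlinarith [h0, hw, h4, h5, mul_nonneg hw.le (sub_nonneg.mpr h5)]

open Real in
/-- **`ψ(v) = A(v) + B(v)·φ > 0` at every vertex.** [cite: MochizukiEtTh2009, Prop 3.4 (ii) p.74] -/
theorem toReal_Psi_pos (v : V) : 0 < (hA v : ℝ) + (hB v : ℝ) * goldenRatio := by
  have h : (hA v : ℝ) + (hB v : ℝ) * goldenRatio = ZPhi.toReal (Psi v.1 v.2) := (ZPhi.toReal_apply _).symm
  rw [h]
  exact lt_of_lt_of_le (mul_pos goldenRatio_pos (toReal_W_pos v.2 v.1)) (gold_mul_W_le_Psi v.2 v.1)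

open Real in
/-- **`ψ` is NOT constant**: `ψ(0,0) = φ`, `ψ(1,0) = φ² = φ + 1`. [cite: MochizukiEtTh2009, Prop 3.4 (ii) p.74] -/
theorem toReal_Psi_zero_ne : (hA (0, 0) : ℝ) + (hB (0, 0) : ℝ) * goldenRatio ≠
    (hA (1, 0) : ℝ) + (hB (1, 0) : ℝ) * goldenRatio := by
  have h0 : (hA (0, 0) : ℝ) + (hB (0, 0) : ℝ) * goldenRatio = ZPhi.toReal (Psi 0 0) := (ZPhi.toReal_apply _).symm
  have h1 : (hA (1, 0) : ℝ) + (hB (1, 0) : ℝ) * goldenRatio = ZPhi.toReal (Psi 1 0) := (ZPhi.toReal_apply _).symm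
  rw [h0, h1, Psi_zero, Psi_zero, toReal_gp, toReal_gp, zero_add, show (1 : ℤ) + 1 = 2 by rfl, zpow_one, zpow_two]
  intro h
  nlinarith [one_lt_goldenRatio]

end Sec3Prop34CnstOfRlfRTreeModel

end Literature.AnabelianGeometry.EtaleTheta

end
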